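import Summits.QuantumFields.BalabanUV.Beta.SecondOrderContactAssembly
import Summits.QuantumFields.BalabanUV.Beta.KernelWardSwapResponse
import Summits.QuantumFields.BalabanUV.Beta.WardLocusSecondOrder

/-!
# `BalabanUV.Beta.SecondOrderSplitDecay` — binder row D1, (L4) W-side: the ANALYTIC binders of an2's ♯-split of the second-order carrier
# (`SecondOrderContactAssembly.W2OfK_sharp_split`) DISCHARGED FROM DECAY — (W-SPLIT-DECAY), generic `K` (hence `j = 0` and every `j`)
# (β sub-cell, D1 formalisation swarm, unit `b2b-balaban-beta-d1-formalise-leaf-10`, gen 2; CLAIM «D1-hR-L4-SPLIT-DECAY»)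

NOT IN PRINT; OUR BOOKKEEPING.  HONEST FRAMING (cell contract, verbatim): «discharging `BetaPertH` makes Bałaban's UV stability
UNCONDITIONAL — a real constructive-QFT result; it is NOT the continuum limit and NOT the Clay problem.»  HONEST DEPENDENCY (verbatim):
«continuum YM on T⁴ ⇐ BetaPertH ∧ nine spine estimates (0/9 proved); BetaPertH ⇐ (D1) ∧ (D4) ∧ CAP+tail; G-an2-4 gates asym, D1 and
NE2/3/4.»  [folklore] analysis bookkeeping (summabilities and localisations from decay); instantiates NO binder of the β-function wall; no
`[cite:]`, no `def`, no `def … : Prop`; NOT D1, NOT `BetaPertH`, NOT continuum, NOT Clay.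

## What

an2-g17's `W2OfK_sharp_split` (p214229) carries SEVENTEEN entrywise-summability / `Loc` binders (`hS hM hg hhin hhout hS₂i hS₂o hM₂i hM₂o hDl
hGl hAS hΞS hAM hΞM hAg`), left to «mechanical discharges» in the owner's hand-over (SKELETON-D1-L4.v1, seat close l.≈10529 item (3)).
**`W2OfK_sharp_split_of_decay`** supplies them all from: `Decays K C m` (`0 ≤ C`, `0 < m`), `Spr 𝕄`, `LocStencil S Cs m`, `VertexFamily M N CM m`,
uniformly bounded bi-tables `S₂`, `M₂`, a BI-LOCALISED diagonal generator family `LocStencil (κ u ↦ diagK (g κ u)) Cg m` (the shape of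
`γ_j • diagK (ctGen …)`, `BorderedHessian.biLoc_diagK_ctGen`) and a bounded second symbol `h`.  Ingredients: `summable_abs_colH/colM` × bounds,
`abs_vertexOfK/M_le`, `SecondOrderTransport.loc_dM`, `SecondOrderResponse.vertexFamily_K2OfK`, `loc_conjV`/`Spr.comp_loc`/`Loc.comp_spr`/
`Loc.neg`/`Loc.add`, `diagK_dressed_eq_vertexOfK` + `vertexFamily_vertexOfK'` for `hGl`, and the `Loc`-based summabilities of
`KernelWardSwapResponse`.  The statement's conclusion is an2's, VERBATIM.
-/

noncomputable section

open Finset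
open scoped BigOperators
open Literature.MathematicalPhysics.QuantumFieldTheory
open Literature.MathematicalPhysics.QuantumFieldTheory.Balaban1983to89
open Literature.MathematicalPhysics.QuantumFieldTheory.Balaban1983to89.Beta
open B12Sec2to5 (l1 l1_nonneg)
open ExpKernelCalculus (MKer Decays BiLoc VertexFamily comp summable_exp_shift')
open KernelWard (bdd_of_biLoc)
open OneStepResolventKernel (Fib wsum LocStencil)
open OneStepKernelFamily (colH vertexOfK vertexFamily_vertexOfK')
open InterLevelTransport (cwsum cwsum_apply)
open SecondOrderResponse (colM vertexOfM dM K2OfK vertex2OfK mixOfK W2OfK vertexFamily_K2OfK)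
open Summit.QuantumFields.BalabanUV.Beta.TameKernelCalculus
open Summit.QuantumFields.BalabanUV.Beta.ChartConjugation (conjV conjW loc_conjV)
open Summit.QuantumFields.BalabanUV.Beta.ChartConjugationReflection (summable_abs_colH abs_le_of_locStencil)
open Summit.QuantumFields.BalabanUV.Beta.BorderedHessian (diagK diagK_apply)
open Summit.QuantumFields.BalabanUV.Beta.WardLocusSecondOrder (summable_abs_colM abs_vertexOfK_le abs_vertexOfM_le)
open Summit.QuantumFields.BalabanUV.Beta.SecondOrderTransport (loc_dM)
open Summit.QuantumFields.BalabanUV.Beta.SecondOrderContactForm (W2OfK_sharp_split)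
open Summit.QuantumFields.BalabanUV.Beta.KernelWardSwapResponse (summable_colH_mul_of_loc summable_colM_mul_of_loc)

namespace Summit.QuantumFields.BalabanUV.Beta.SecondOrderSplitDecay

variable {d N : ℕ}

/-! ## §1 Scalar summabilities and the dressed diagonal -/

/-- [folklore] `u ↦ colH K N μ y κ u · T u` is summable for decaying `K` and bounded `T`. -/
theorem summable_colH_mul_bdd {K : MKer (d + 1) (Fib d)} (hK : ∃ δ C : ℝ, 0 < δ ∧ 0 ≤ C ∧ Decays K C δ) {T : (Fin (d + 1) → ℤ) → ℝ}
    {B : ℝ} (hT : ∀ u, |T u| ≤ B) (μ : Fin (d + 1)) (y : Fin (d + 1) → ℤ) (κ : Fin (d + 1)) :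
    Summable fun u => colH K N μ y κ u * T u :=
  Summable.of_norm_bounded ((summable_abs_colH (N := N) hK μ y κ).mul_right B) (fun u => by
    rw [Real.norm_eq_abs, abs_mul]; exact mul_le_mul_of_nonneg_left (hT u) (abs_nonneg _))

/-- [folklore] `w ↦ colM K N μ y ρ w · T w` is summable for decaying `K` and bounded `T`. -/
theorem summable_colM_mul_bdd [NeZero N] {K : MKer (d + 1) (Fib d)} (hK : ∃ δ C : ℝ, 0 < δ ∧ 0 ≤ C ∧ Decays K C δ)
    {T : (Fin (d + 1) → ℤ) → ℝ} {B : ℝ} (hT : ∀ w, |T w| ≤ B) (μ : Fin (d + 1)) (y : Fin (d + 1) → ℤ) (ρ : Fin (d + 1)) :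
    Summable fun w => colM K N μ y ρ w * T w :=
  Summable.of_norm_bounded ((summable_abs_colM (N := N) hK μ y ρ).mul_right B) (fun w => by
    rw [Real.norm_eq_abs, abs_mul]; exact mul_le_mul_of_nonneg_left (hT w) (abs_nonneg _))

/-- [folklore] `|Σ_κ Σ'_u colH K N μ y κ u · T κ u| ≤ Σ_κ (Σ'_u |colH K N μ y κ u|) · B` for bounded `T`. -/
theorem abs_fold_le {K : MKer (d + 1) (Fib d)} (hK : ∃ δ C : ℝ, 0 < δ ∧ 0 ≤ C ∧ Decays K C δ)
    {T : Fin (d + 1) → (Fin (d + 1) → ℤ) → ℝ} {B : ℝ} (hT : ∀ κ u, |T κ u| ≤ B) (μ : Fin (d + 1)) (y : Fin (d + 1) → ℤ) :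
    |∑ κ, ∑' u, colH K N μ y κ u * T κ u| ≤ ∑ κ, (∑' u, |colH K N μ y κ u|) * B := by
  refine (Finset.abs_sum_le_sum_abs _ _).trans (Finset.sum_le_sum fun κ _ => ?_)
  have hs := summable_colH_mul_bdd (N := N) hK (hT κ) μ y κ
  calc |∑' u, colH K N μ y κ u * T κ u| ≤ ∑' u, |colH K N μ y κ u * T κ u| := by
        rw [← Real.norm_eq_abs]; exact norm_tsum_le_tsum_norm hs.abs
    _ ≤ ∑' u, |colH K N μ y κ u| * B := hs.abs.tsum_le_tsum (fun u => by rw [abs_mul]; exact mul_le_mul_of_nonneg_left (hT κ u) (abs_nonneg _))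
        ((summable_abs_colH (N := N) hK μ y κ).mul_right B)
    _ = (∑' u, |colH K N μ y κ u|) * B := tsum_mul_right

/-- [folklore] The diagonal kernel of a dressed symbol is the chain-rule vertex of the diagonal family (entrywise). -/
theorem diagK_dressed_eq_vertexOfK (K : MKer (d + 1) (Fib d)) (N : ℕ) (g : Fin (d + 1) → (Fin (d + 1) → ℤ) → (Fin (d + 1) → ℤ) → Fib d → ℝ)
    (μ : Fin (d + 1)) (y : Fin (d + 1) → ℤ) :
    diagK (fun p c => ∑ κ, ∑' u, colH K N μ y κ u * g κ u p c) = vertexOfK K N (fun κ u => diagK (g κ u)) μ y := by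
  classical
  funext x z a b
  simp only [vertexOfK, OneStepResolventKernel.wsum, diagK_apply]
  by_cases h : x = z ∧ a = b
  · simp only [if_pos h]
  · simp only [if_neg h, mul_zero, tsum_zero, Finset.sum_const_zero]

/-- [folklore] A bi-localised diagonal generator family has bounded symbols. -/
theorem abs_symbol_le_of_locStencil {g : Fin (d + 1) → (Fin (d + 1) → ℤ) → (Fin (d + 1) → ℤ) → Fib d → ℝ} {Cg m : ℝ}
    (hg : LocStencil (fun κ u => diagK (g κ u)) Cg m) (hm : 0 ≤ m) (κ : Fin (d + 1)) (u p : Fin (d + 1) → ℤ) (c : Fib d) :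
    |g κ u p c| ≤ Cg := by
  have h := abs_le_of_locStencil hg hm κ u p p c c
  simpa only [diagK_apply, and_self, if_true] using h

/-! ## §2 The ♯-split with every analytic binder discharged from decay -/

/-- [folklore] **(W-SPLIT-DECAY) `W2OfK_sharp_split` WITH ITS ANALYTIC BINDERS DISCHARGED FROM DECAY.**  For a decaying `K`, spread `𝕄`,
a local field table `S`, a coarse-local multiplier table `M`, bounded bi-tables `S₂`, `M₂`, a bi-localised diagonal generator family `g` and a
bounded second symbol `h` — an2's conclusion VERBATIM. -/
theorem W2OfK_sharp_split_of_decay [NeZero N] {K 𝕄 : MKer (d + 1) (Fib d)} {C m : ℝ} (hKd : Decays K C m) (hC : 0 ≤ C) (hm : 0 < m)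
    (h𝕄 : Spr 𝕄) {S : Fin (d + 1) → (Fin (d + 1) → ℤ) → MKer (d + 1) (Fib d)} {Cs : ℝ} (hSl : LocStencil S Cs m)
    {M : Fin (d + 1) → (Fin (d + 1) → ℤ) → MKer (d + 1) (Fib d)} {CM : ℝ} (hMl : VertexFamily M N CM m)
    {S₂ M₂ : Fin (d + 1) → (Fin (d + 1) → ℤ) → Fin (d + 1) → (Fin (d + 1) → ℤ) → MKer (d + 1) (Fib d)} {B₂ B₂' : ℝ}
    (hB₂ : ∀ κ u κ' u' x z a b, |S₂ κ u κ' u' x z a b| ≤ B₂) (hB₂' : ∀ κ u ρ w x z a b, |M₂ κ u ρ w x z a b| ≤ B₂')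
    {g : Fin (d + 1) → (Fin (d + 1) → ℤ) → (Fin (d + 1) → ℤ) → Fib d → ℝ} {Cg : ℝ} (hgl : LocStencil (fun κ u => diagK (g κ u)) Cg m)
    {h : Fin (d + 1) → (Fin (d + 1) → ℤ) → Fin (d + 1) → (Fin (d + 1) → ℤ) → (Fin (d + 1) → ℤ) → Fib d → ℝ} {Bh : ℝ}
    (hhb : ∀ κ u κ' u' p c, |h κ u κ' u' p c| ≤ Bh)
    (μ : Fin (d + 1)) (y : Fin (d + 1) → ℤ) (ν : Fin (d + 1)) (y' : Fin (d + 1) → ℤ) :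
    W2OfK K N (fun κ u => S κ u + conjV 𝕄 (diagK (g κ u))) M
        (fun κ u κ' u' => S₂ κ u κ' u' + conjW 𝕄 (S κ u) (S κ' u') (diagK (g κ u)) (diagK (g κ' u')) (diagK (h κ u κ' u')))
        (fun κ u ρ w => M₂ κ u ρ w + conjV (M ρ w) (diagK (g κ u))) μ y ν y' =
      W2OfK K N S M S₂ M₂ μ y ν y' +
        conjW 𝕄 (dM K N S M μ y) (dM K N S M ν y') (diagK fun p c => ∑ κ, ∑' u, colH K N μ y κ u * g κ u p c)
          (diagK fun p c => ∑ κ', ∑' u', colH K N ν y' κ' u' * g κ' u' p c)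
          (diagK fun p c => (∑ κ, ∑' u, colH K N μ y κ u * ∑ κ', ∑' u', colH K N ν y' κ' u' * h κ u κ' u' p c) +
            ∑ κ, ∑' u, colH (K2OfK K N S M ν y' +
              -(comp (comp K (conjV 𝕄 (diagK fun p c => ∑ κ, ∑' u, colH K N ν y' κ u * g κ u p c))) K)) N μ y κ u * g κ u p c) +
        dM (-(comp (comp K (conjV 𝕄 (diagK fun p c => ∑ κ, ∑' u, colH K N ν y' κ u * g κ u p c))) K)) N S M μ y := by
  -- the decay data in the shapes the helpers want
  have hK : ∃ δ C : ℝ, 0 < δ ∧ 0 ≤ C ∧ Decays K C δ := ⟨m, C, hm, hC, hKd⟩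
  have hKs : Spr K := ⟨C, m, hm, hKd⟩
  have hSb : ∀ κ u x z a b, |S κ u x z a b| ≤ Cs := abs_le_of_locStencil hSl hm.le
  have hMb : ∀ ρ w x z a b, |M ρ w x z a b| ≤ CM := fun ρ w x z a b => bdd_of_biLoc (hMl ρ w) hm.le x z a b
  have hgb : ∀ κ u p c, |g κ u p c| ≤ Cg := fun κ u p c => abs_symbol_le_of_locStencil hgl hm.le κ u p c
  -- the localised objects
  have hDl : Loc (dM K N S M ν y') := loc_dM hKd hC hSl hMl hm le_rfl ν y'
  have hGl : Loc (diagK fun p c => ∑ κ, ∑' u, colH K N ν y' κ u * g κ u p c) := by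
    rw [diagK_dressed_eq_vertexOfK]
    obtain ⟨Cv, δv, hδv, hV⟩ := vertexFamily_vertexOfK' (N := N) hK hgl hm
    exact ⟨_, _, Cv, δv, hδv, hV ν y'⟩
  have hK2 : Loc (K2OfK K N S M ν y') := ⟨_, _, _, _, by positivity, vertexFamily_K2OfK hKd hC hm hSl hMl ν y'⟩
  have hΞ : Loc (-(comp (comp K (conjV 𝕄 (diagK fun p c => ∑ κ, ∑' u, colH K N ν y' κ u * g κ u p c))) K)) :=
    ((hKs.comp_loc (loc_conjV h𝕄 hGl)).comp_spr hKs).neg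
  -- uniform bounds of the dressed objects
  have hVS₂ : ∀ κ u x z a b, |vertexOfK K N (S₂ κ u) ν y' x z a b| ≤ ∑ κ₁, (∑' u₁, |colH K N ν y' κ₁ u₁|) * B₂ :=
    fun κ u x z a b => abs_vertexOfK_le hK (fun κ₁ u₁ x z a b => hB₂ κ u κ₁ u₁ x z a b) ν y' x z a b
  have hVM₂ : ∀ (ν : Fin (d + 1)) (y' : Fin (d + 1) → ℤ) κ u x z a b,
      |vertexOfM K N (M₂ κ u) ν y' x z a b| ≤ ∑ ρ, (∑' w, |colM K N ν y' ρ w|) * B₂' :=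
    fun ν y' κ u x z a b => abs_vertexOfM_le hK (fun ρ w x z a b => hB₂' κ u ρ w x z a b) ν y' x z a b
  have hH : ∀ κ u p c, |∑ κ', ∑' u', colH K N ν y' κ' u' * h κ u κ' u' p c| ≤ ∑ κ', (∑' u', |colH K N ν y' κ' u'|) * Bh :=
    fun κ u p c => abs_fold_le (N := N) hK (fun κ' u' => hhb κ u κ' u' p c) ν y'
  exact W2OfK_sharp_split K 𝕄 N hKs h𝕄 μ y ν y'
    (fun μ y κ x z a b => summable_colH_mul_bdd hK (fun u => hSb κ u x z a b) μ y κ)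
    (fun ν y' ρ x z a b => summable_colM_mul_bdd hK (fun w => hMb ρ w x z a b) ν y' ρ)
    (fun μ y κ p c => summable_colH_mul_bdd hK (fun u => hgb κ u p c) μ y κ)
    (fun κ u κ' p c => summable_colH_mul_bdd hK (fun u' => hhb κ u κ' u' p c) ν y' κ')
    (fun κ p c => summable_colH_mul_bdd hK (fun u => hH κ u p c) μ y κ)
    (fun κ u κ' x z a b => summable_colH_mul_bdd hK (fun u' => hB₂ κ u κ' u' x z a b) ν y' κ')
    (fun κ x z a b => summable_colH_mul_bdd hK (fun u => hVS₂ κ u x z a b) μ y κ)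
    (fun ν y' κ u ρ x z a b => summable_colM_mul_bdd hK (fun w => hB₂' κ u ρ w x z a b) ν y' ρ)
    (fun μ y ν y' κ x z a b => summable_colH_mul_bdd hK (fun u => hVM₂ ν y' κ u x z a b) μ y κ)
    hDl hGl
    (fun κ x z a b => summable_colH_mul_of_loc (N := N) hK2 hSb μ y κ x z a b)
    (fun κ x z a b => summable_colH_mul_of_loc (N := N) hΞ hSb μ y κ x z a b)
    (fun ρ x z a b => summable_colM_mul_of_loc (N := N) hK2 hMb μ y ρ x z a b)
    (fun ρ x z a b => summable_colM_mul_of_loc (N := N) hΞ hMb μ y ρ x z a b)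
    (fun μ' y'' κ p c => by
      obtain ⟨p₀, q₀, C₀, δ₀, hδ₀, hL⟩ := hK2.add hΞ
      refine Summable.of_norm_bounded ((summable_exp_shift' hδ₀ p₀).mul_left (C₀ * |Cg|)) (fun u => ?_)
      rw [Real.norm_eq_abs, abs_mul]
      have h1 : |colH (K2OfK K N S M ν y' + -(comp (comp K (conjV 𝕄 (diagK fun p c => ∑ κ, ∑' u, colH K N ν y' κ u * g κ u p c))) K))
          N μ' y'' κ u| ≤ C₀ * Real.exp (-δ₀ * l1 (u - p₀)) := by
        refine (hL u _ _ _).trans (mul_le_mul_of_nonneg_left ?_ (hL.nonneg (Sum.inl 0)))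
        exact Real.exp_le_exp.mpr (by nlinarith [l1_nonneg ((N : ℤ) • y'' - q₀), hδ₀])
      calc |colH (K2OfK K N S M ν y' + -(comp (comp K (conjV 𝕄 (diagK fun p c => ∑ κ, ∑' u, colH K N ν y' κ u * g κ u p c))) K))
              N μ' y'' κ u| * |g κ u p c| ≤ (C₀ * Real.exp (-δ₀ * l1 (u - p₀))) * |Cg| :=
            mul_le_mul h1 ((hgb κ u p c).trans (le_abs_self _)) (abs_nonneg _) ((abs_nonneg _).trans h1)
        _ = C₀ * |Cg| * Real.exp (-δ₀ * l1 (u - p₀)) := by ring)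

end Summit.QuantumFields.BalabanUV.Beta.SecondOrderSplitDecay

end
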